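import Literature.Barriers.QuantumAdvantage.PauliPathTruncationWorstCase
import Mathlib.Analysis.SpecialFunctions.Pow.Real
import HarnessLib

/-!
# Barrier catalogue `QuantumAdvantage` — PROOF of `pauliPathTruncation_worstCase`
# (González-García–Cirac–Trivedi 2025, Lemma 6 (v) for the circuit of Lemma 5)

Topic `Literature/Barriers/QuantumAdvantage` (D-0021; cell `qa-dq`, census row DQ-N7). This file DISCHARGES
the named fact `Literature.Barriers.QuantumAdvantage.pauliPathTruncation_worstCase` of the sibling file
`PauliPathTruncationWorstCase.lean` by carrying out the printed computation inside the tree's Pauli-path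
model (`PauliPathIntegral.lean`: `noisyValue`, `pathCoeff`; `PauliPathOrthogonality.lean`: `truncValue`):
`theorem pauliPathTruncation_worstCase_holds : pauliPathTruncation_worstCase`. Net D-0026 debt −1; no new
definitions of mathematical content beyond the bookkeeping of the computation (block tensors, the block
generating sum).

HONEST FRAMING: a no-go for ONE classical technique class (Hamming-weight truncation of the Pauli path
sum) on ONE explicit, otherwise trivially simulable circuit family; nothing here bears on classical
simulability in general or on BQP vs BPP.

## Source (read on the page by the typing seat: `lit read arxiv:2407.16068`, tex chunks p0008, p0018–p0019)

G. González-García, J. I. Cirac, R. Trivedi, *Pauli path simulations of noisy quantum circuits beyond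
average case*, Quantum 9 (2025) 1730 = arXiv:2407.16068 [GonzalezGarciaCiracTrivedi2025PauliPathBeyondAverageQuantum]:
§3 (the model: noise layer `T_p = 𝒩_p^{⊗n}` before the first and after every layer;
`⟨O⟩_err = Σ_s f(s)(1−p)^{|s|}`, `f(s) = 2^{−n(d+1)} tr(O s_d) tr(s_d U_d s_{d−1} U_d†) ⋯ tr(s_0 ρ_0)`;
`⟨O⟩_ℓ = Σ_{w≤ℓ} F_w(1−p)^w`); **Lemma 5** (the majority gate `V`, "`V†(Z_1)V = (Z_1+Z_2+Z_3)/2 −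
Z_1Z_2Z_3/2`", per block `F_1 = F_3 = 0`, `F_2 = 3/2`, `F_4 = −1/2`, `F_{2k} = (3/2)^k` for `𝒞 = V^{⊗n/3}`,
`O_k = ∏ Z_{3i−2}`, `ρ_0 = |0⟩⟨0|^{⊗n}`); **Lemma 6 (v)**: "For `2k < ℓ ≤ 9k/4`:
`|E^{(ℓ)}_{𝒞_k}| ≥ ((3/2)(1−p)²)^k − 1 = 2^{Ω(ℓ)}, ∀ p < 1−√(2/3)`", `E^{(ℓ)}_{𝒞_k} = Σ_{w>ℓ} F_w(𝒞_k)(1−p)^w`.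

## The proof (following the printed computation)

1. *Block structure* (`blockTensor`, …): the layer `V^{⊗k}`, the observable `(Z⊗I⊗I)^{⊗k}`, the input
   `|0⟩⟨0|^{⊗3k}` and every Pauli string are block tensors on the register `Fin k × Fin 3 → Bool`, and
   products / adjoints / traces of block tensors are blockwise.
2. *The block* (`majority_conj_zII_apply`, `blockAmp_bits`, `block_sum`): `V†Z_1V` is the diagonal
   `(−1)^{MAJ}`, whose Walsh coefficients are `1/2` on `Z_1, Z_2, Z_3` and `−1/2` on `Z_1Z_2Z_3`; with the
   input bracket `⟨000|b|000⟩` only `Z`-type strings enter, so per block the generating weights are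
   `Σ_b τ(b) F(|b|) = (3/2)F(1) − (1/2)F(3)`.
3. *The path sum* (`pathCoeff_pair`, `filter_sum_pathCoeff_eq`): in the depth-one path `(s_0, s_1)` the
   read-out forces `s_1 = O_k` (weight `k`), and the remaining sum over `s_0` factorises into the
   matrix-free block sum `S_k(P)` for every weight predicate `P`.
4. *Closed form* (`blockSum_eq`, `error_eq`, `noisyValue_eq`): by the recursion
   `S_{k+1}(P) = (3/2)x²S_k(P(·+2)) − (1/2)x⁴S_k(P(·+4))` and Pascal,
   `S_k(P) = ((3/2)x²)^k Σ_{j≤k} [P(2k+2j)] C(k,j)(−x²/3)^j` (`x = 1−p`), i.e.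
   `F_{2k+2j}(𝒞_k) = C(k,j)(3/2)^{k−j}(−1/2)^j`; `⟨O_k⟩_err = ((3/2)x² − x⁴/2)^k ∈ [0,1]`.
5. *The estimate* (`lemma6v_real`): with `m = ⌊(ℓ−2k)/2⌋ ≤ k/8` the kept sum `Σ_{j≤m} C(k,j)(−x²/3)^j` is an
   alternating sum whose terms grow by a factor `≥ 14/9` (because `x² > 2/3` and `8(j+1) ≤ k`), hence is
   `≥ 1` (`m` even) or `≤ −1` (`m ≥ 3` odd) or `= 1 − kx²/3` (`m = 1`, where `k ≥ 8`; `k = 8` is checked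
   by a numerical estimate `(9/8)^8 < 2.57`); in each case `|⟨O⟩_err − ⟨O⟩_ℓ| ≥ ((3/2)x²)^k − 1`.
   (The printed proof says "w.l.o.g. `k, ℓ` even"; the typed fact quantifies over all `k, ℓ` in the
   window, and the case analysis above covers them all.)
-/

noncomputable section
open Matrix Finset Complex

namespace Literature.Barriers.QuantumAdvantage

open Literature.Computability.QuantumComplexity
open Literature.Computability.QuantumComplexity.PauliPath

namespace GGCT

/-! ### Block tensor products on a register `κ × λ → Bool` -/

section Blocks

variable {κ μ : Type*} [Fintype κ] [DecidableEq κ] [Fintype μ] [DecidableEq μ]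

/-- The **block tensor product** `⊗_{i : κ} A_i` of matrices `A_i` on the local register `μ → Bool`, as a
matrix on the product register `κ × μ → Bool` (entries `∏_i A_i(x|_i, y|_i)`): the structure
"`V^{⊗n/3} = V_{123} ⊗ V_{456} ⊗ ⋯`" of the witness circuit. [cite: GonzalezGarciaCiracTrivedi2025PauliPathBeyondAverageQuantum, Lemma 5 (𝒞 = V^{⊗n/3})] -/
def blockTensor (A : κ → Matrix (μ → Bool) (μ → Bool) ℂ) : Matrix (κ × μ → Bool) (κ × μ → Bool) ℂ :=
  Matrix.of fun x y => ∏ i, A i (fun j => x (i, j)) (fun j => y (i, j))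

omit [DecidableEq κ] [Fintype μ] [DecidableEq μ] in
/-- Entries of `blockTensor`. [folklore] -/
@[simp] private theorem blockTensor_apply (A : κ → Matrix (μ → Bool) (μ → Bool) ℂ) (x y : κ × μ → Bool) :
    blockTensor A x y = ∏ i, A i (fun j => x (i, j)) (fun j => y (i, j)) := rfl

/-- Sums over the product register factor through currying `(κ × μ → γ) ≃ (κ → μ → γ)`. [folklore] -/
private theorem sum_curry {γ β : Type*} [Fintype γ] [DecidableEq γ] [AddCommMonoid β] (g : (κ × μ → γ) → β) :
    ∑ z : κ × μ → γ, g z = ∑ z : κ → μ → γ, g (fun w => z w.1 w.2) := by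
  refine Fintype.sum_equiv (Equiv.curry κ μ γ) _ _ fun z => ?_
  rfl

/-- Block tensors multiply blockwise: `(⊗A_i)(⊗B_i) = ⊗(A_iB_i)`. [cite: GonzalezGarciaCiracTrivedi2025PauliPathBeyondAverageQuantum, Lemma 5 (the computation is done "per block": 𝒞 = V^{⊗n/3})] -/
theorem blockTensor_mul (A B : κ → Matrix (μ → Bool) (μ → Bool) ℂ) :
    blockTensor A * blockTensor B = blockTensor fun i => A i * B i := by
  ext x y
  rw [Matrix.mul_apply, sum_curry]
  simp only [blockTensor_apply, ← Finset.prod_mul_distrib, Matrix.mul_apply]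
  rw [← Fintype.prod_sum (fun i (c : μ → Bool) => A i (fun j => x (i, j)) c * B i c (fun j => y (i, j)))]

omit [DecidableEq κ] [Fintype μ] [DecidableEq μ] in
/-- Adjoint of a block tensor: `(⊗A_i)† = ⊗A_i†`. [cite: GonzalezGarciaCiracTrivedi2025PauliPathBeyondAverageQuantum, Lemma 5 (V^{⊗n/3})] -/
theorem conjTranspose_blockTensor (A : κ → Matrix (μ → Bool) (μ → Bool) ℂ) :
    (blockTensor A)ᴴ = blockTensor fun i => (A i)ᴴ := by
  ext x y
  simp [blockTensor_apply, Matrix.conjTranspose_apply]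

/-- Trace of a block tensor: `Tr(⊗A_i) = ∏_i Tr(A_i)`. [cite: GonzalezGarciaCiracTrivedi2025PauliPathBeyondAverageQuantum, Lemma 5 (proof: "the total contribution … is F_2 = 3/2 per block", F_{2k} = (3/2)^k)] -/
theorem trace_blockTensor (A : κ → Matrix (μ → Bool) (μ → Bool) ℂ) :
    (blockTensor A).trace = ∏ i, (A i).trace := by
  simp only [Matrix.trace, Matrix.diag_apply]
  rw [sum_curry]
  simp only [blockTensor_apply]
  rw [← Fintype.prod_sum (fun i (c : μ → Bool) => A i c c)]

omit [DecidableEq κ] [DecidableEq μ] in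
/-- A Pauli string on the product register is the block tensor of its block strings. [cite: GonzalezGarciaCiracTrivedi2025PauliPathBeyondAverageQuantum, Lemma 5 (s = s_1 ⊗ ⋯ per block)] -/
theorem pauliString_eq_blockTensor (S : κ × μ → Pauli) :
    pauliString S = blockTensor fun i => pauliString fun j => S (i, j) := by
  ext x y
  simp only [pauliString_eq, tensorAll_apply, blockTensor_apply]
  rw [Fintype.prod_prod_type]

omit [DecidableEq κ] [DecidableEq μ] in
/-- The Hamming weight on the product register is the sum of the block weights (`|s| = Σ_blocks |s_i|`). [cite: GonzalezGarciaCiracTrivedi2025PauliPathBeyondAverageQuantum, §3 (|s| = |s_0| + ⋯ + |s_d|) and Lemma 5] -/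
theorem strWeight_eq_sum_blocks (S : κ × μ → Pauli) :
    strWeight S = ∑ i, strWeight fun j => S (i, j) := by
  simp only [strWeight_eq, Finset.card_filter]
  rw [Fintype.sum_prod_type]

end Blocks

/-! ### The majority block: `M† (Z⊗I⊗I) M` is the diagonal `(−1)^{MAJ}` -/

/-- The observable's block pattern `Z ⊗ I ⊗ I` (`O_k = ∏_i Z_{3i−2}`). [cite: GonzalezGarciaCiracTrivedi2025PauliPathBeyondAverageQuantum, Lemma 5 (O_k = ∏_{i=1}^k Z_{3i−2})] -/
def zII : Fin 3 → Pauli := fun j => if j = 0 then Pauli.Z else Pauli.I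

/-- `GGCT.obs` is `Z ⊗ I ⊗ I` on every block. [cite: GonzalezGarciaCiracTrivedi2025PauliPathBeyondAverageQuantum, Lemma 5 (O_k)] -/
theorem obs_eq_blocks (k : ℕ) (w : Fin k × Fin 3) : obs k w = zII w.2 := rfl

/-- A `Z`-type string (letters in `{I, Z}`) is diagonal with entries `±1`. [folklore] -/
private theorem pauliString_apply_of_IZ {μ : Type*} [Fintype μ] (b : μ → Pauli)
    (hb : ∀ j, b j = Pauli.I ∨ b j = Pauli.Z) (c d : μ → Bool) :
    pauliString b c d = if c = d then ∏ j, (if b j = Pauli.Z ∧ c j then (-1 : ℂ) else 1) else 0 := by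
  rw [pauliString_eq, tensorAll_apply]
  by_cases hcd : c = d
  · subst hcd
    rw [if_pos rfl]
    refine Finset.prod_congr rfl fun j _ => ?_
    rcases hb j with h | h <;> simp [h]
  · rw [if_neg hcd]
    obtain ⟨j, hj⟩ : ∃ j, c j ≠ d j := by
      by_contra h; push Not at h; exact hcd (funext h)
    refine Finset.prod_eq_zero (Finset.mem_univ j) ?_
    rcases hb j with h | h <;> simp [h, hj]

/-- `Z ⊗ I ⊗ I` is a `Z`-type string. [folklore] -/
private theorem zII_IZ (j : Fin 3) : zII j = Pauli.I ∨ zII j = Pauli.Z := by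
  unfold zII; split_ifs <;> simp

/-- The sign `z(c) = ⟨c|Z⊗I⊗I|c⟩ = (−1)^{c_0}`. [cite: GonzalezGarciaCiracTrivedi2025PauliPathBeyondAverageQuantum, Lemma 5 (V†Z_1V)] -/
def zSign (c : Fin 3 → Bool) : ℂ := if c 0 then -1 else 1

/-- Entries of `Z ⊗ I ⊗ I`: diagonal, `z(c)`. [cite: GonzalezGarciaCiracTrivedi2025PauliPathBeyondAverageQuantum, Lemma 5 (Z_1)] -/
theorem pauliString_zII_apply (c d : Fin 3 → Bool) :
    pauliString zII c d = if c = d then zSign c else 0 := by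
  rw [pauliString_apply_of_IZ zII zII_IZ]
  split_ifs with h
  · rw [Fin.prod_univ_three]
    simp [zII, zSign]
  · rfl

/-- **`V† Z_1 V` is diagonal** with entries `z(flip c)`, `flip` the majority permutation `|100⟩ ↔ |011⟩`
(a permutation matrix conjugates a diagonal matrix to a diagonal matrix). [cite: GonzalezGarciaCiracTrivedi2025PauliPathBeyondAverageQuantum, Lemma 5 ("V†(Z_1)V = (Z_1+Z_2+Z_3)/2 − Z_1Z_2Z_3/2")] -/
theorem majority_conj_zII_apply (a b : Fin 3 → Bool) :
    (majorityGateᴴ * pauliString zII * majorityGate) a b =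
      if a = b then zSign (majorityFlip a) else 0 := by
  rw [Matrix.mul_apply]
  have inner : ∀ d : Fin 3 → Bool, (majorityGateᴴ * pauliString zII) a d =
      if d = majorityFlip a then zSign d else 0 := by
    intro d
    rw [Matrix.mul_apply]
    simp only [Matrix.conjTranspose_apply, majorityGate_apply, pauliString_zII_apply]
    rw [Finset.sum_eq_single (majorityFlip a)]
    · by_cases hd : d = majorityFlip a
      · subst hd; simp
      · rw [if_neg (Ne.symm hd), if_neg hd]; simp
    · intro c _ hc; rw [if_neg hc]; simp
    · intro h; exact absurd (Finset.mem_univ _) h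
  simp only [inner, majorityGate_apply]
  rw [Finset.sum_eq_single (majorityFlip a)]
  · simp only [if_true]
    by_cases hab : a = b
    · subst hab; simp
    · rw [if_neg hab, if_neg]; · simp
      intro h
      exact hab (by simpa [majorityFlip_majorityFlip] using congrArg majorityFlip h)
  · intro d _ hd; rw [if_neg hd]; simp
  · intro h; exact absurd (Finset.mem_univ _) h

/-- The block transition bracket as a character sum: `Tr(Z_1 · V b V†) = Σ_c z(flip c) ⟨c|b|c⟩`. [cite: GonzalezGarciaCiracTrivedi2025PauliPathBeyondAverageQuantum, Lemma 5 (proof)] -/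
theorem blockAmp_eq (b : Fin 3 → Pauli) :
    (pauliString zII * (majorityGate * pauliString b * majorityGateᴴ)).trace =
      ∑ c : Fin 3 → Bool, zSign (majorityFlip c) * pauliString b c c := by
  have hcyc : (pauliString zII * (majorityGate * pauliString b * majorityGateᴴ)).trace =
      (majorityGateᴴ * pauliString zII * majorityGate * pauliString b).trace := by
    rw [Matrix.mul_assoc majorityGateᴴ, Matrix.mul_assoc majorityGateᴴ, Matrix.trace_mul_comm majorityGateᴴ]
    simp only [Matrix.mul_assoc]
  have hdiag : ∀ c : Fin 3 → Bool,
      (majorityGateᴴ * pauliString zII * majorityGate * pauliString b) c c =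
        zSign (majorityFlip c) * pauliString b c c := by
    intro c
    rw [Matrix.mul_apply]
    simp only [majority_conj_zII_apply, ite_mul, zero_mul, Finset.sum_ite_eq, Finset.mem_univ, if_true]
  rw [hcyc, Matrix.trace]
  simp only [Matrix.diag_apply, hdiag]

/-! ### Evaluating the block: the eight `Z`-type strings -/

/-- Sums over `Fin 3 → α` as triple sums. [folklore] -/
private theorem sum_fin3 {α M : Type*} [Fintype α] [AddCommMonoid M] (g : (Fin 3 → α) → M) :
    ∑ c, g c = ∑ c0, ∑ c1, ∑ c2, g ![c0, c1, c2] := by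
  rw [← (Fin.consEquiv fun _ => α).sum_comp, Fintype.sum_prod_type]
  refine Finset.sum_congr rfl fun c0 _ => ?_
  rw [← (Fin.consEquiv fun _ => α).sum_comp, Fintype.sum_prod_type]
  refine Finset.sum_congr rfl fun c1 _ => ?_
  rw [← (Fin.consEquiv fun _ => α).sum_comp, Fintype.sum_prod_type]
  refine Finset.sum_congr rfl fun c2 _ => ?_
  rw [Fintype.sum_unique]
  rfl

/-- **The majority gate writes the majority into the first bit**: `(flip c)_0 = MAJ(c_0,c_1,c_2)`. [cite: GonzalezGarciaCiracTrivedi2025PauliPathBeyondAverageQuantum, Lemma 5 ("V … performs majority voting: V|000⟩=|000⟩, V|100⟩=|011⟩, …")] -/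
theorem majorityFlip_apply_zero (c0 c1 c2 : Bool) :
    majorityFlip ![c0, c1, c2] 0 = (c0 && c1 || c0 && c2 || c1 && c2) := by
  cases c0 <;> cases c1 <;> cases c2 <;> decide

/-- The `Z`-type string with `Z` exactly at the marked sites. [folklore] -/
private def bits (t : Fin 3 → Bool) : Fin 3 → Pauli := fun j => if t j then Pauli.Z else Pauli.I

/-- `bits t` is a `Z`-type string. [folklore] -/
private theorem bits_IZ (t : Fin 3 → Bool) (j : Fin 3) : bits t j = Pauli.I ∨ bits t j = Pauli.Z := by
  unfold bits; split_ifs <;> simp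

/-- Diagonal entries of `bits t`: the character `(−1)^{t·c}`. [folklore] -/
private theorem pauliString_bits_apply (t c : Fin 3 → Bool) :
    pauliString (bits t) c c = ∏ j, (if t j ∧ c j then (-1 : ℂ) else 1) := by
  rw [pauliString_apply_of_IZ _ (bits_IZ t), if_pos rfl]
  refine Finset.prod_congr rfl fun j _ => ?_
  simp [bits]

/-- The weight of `bits t` is the number of marked sites. [folklore] -/
private theorem strWeight_bits (t0 t1 t2 : Bool) : strWeight (bits ![t0, t1, t2]) =
    (if t0 then 1 else 0) + (if t1 then 1 else 0) + (if t2 then 1 else 0) := by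
  rw [strWeight_eq, Finset.card_filter, Fin.sum_univ_three]
  simp only [bits, Matrix.cons_val_zero, Matrix.cons_val_one, Matrix.head_cons, Matrix.cons_val_two,
    Matrix.tail_cons]
  cases t0 <;> cases t1 <;> cases t2 <;> rfl

/-- **The block transition bracket on the eight `Z`-type strings**: `4` on `Z_1, Z_2, Z_3`, `−4` on
`Z_1Z_2Z_3`, `0` on `I`, `Z_iZ_j` — the Walsh coefficients of `(−1)^{MAJ}`, i.e.
"`V†(Z_1)V = (Z_1+Z_2+Z_3)/2 − Z_1Z_2Z_3/2`" (times `Tr 1 = 8`). [cite: GonzalezGarciaCiracTrivedi2025PauliPathBeyondAverageQuantum, Lemma 5 (display for V†(Z_1)V)] -/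
theorem blockAmp_bits (t0 t1 t2 : Bool) :
    ∑ c : Fin 3 → Bool, zSign (majorityFlip c) * pauliString (bits ![t0, t1, t2]) c c =
      if (t0 && !t1 && !t2) || (!t0 && t1 && !t2) || (!t0 && !t1 && t2) then 4
      else if t0 && t1 && t2 then -4 else 0 := by
  rw [sum_fin3]
  simp only [Fintype.sum_bool, zSign, majorityFlip_apply_zero, pauliString_bits_apply, Fin.prod_univ_three,
    Matrix.cons_val_zero, Matrix.cons_val_one, Matrix.head_cons, Matrix.cons_val_two, Matrix.tail_cons]
  cases t0 <;> cases t1 <;> cases t2 <;> norm_num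

/-- `⟨0…0|b|0…0⟩ = 1` on `{I,Z}`-strings and `0` otherwise (the input bracket `Tr(s_0 ρ_0)` with
`ρ_0 = |0⟩⟨0|^{⊗n}`). [cite: GonzalezGarciaCiracTrivedi2025PauliPathBeyondAverageQuantum, §3 (f(s) = ⋯ tr(s_0 ρ_0)) and Lemma 5 (ρ_0 = (|0⟩⟨0|)^{⊗n})] -/
theorem pauliString_zero_zero {μ : Type*} [Fintype μ] (b : μ → Pauli) :
    pauliString b (fun _ => false) (fun _ => false) =
      if ∀ j, b j = Pauli.I ∨ b j = Pauli.Z then 1 else 0 := by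
  rw [pauliString_eq, tensorAll_apply]
  split_ifs with h
  · refine Finset.prod_eq_one fun j _ => ?_
    rcases h j with hj | hj <;> simp [hj]
  · push Not at h
    obtain ⟨j, hj1, hj2⟩ := h
    refine Finset.prod_eq_zero (Finset.mem_univ j) ?_
    cases hb : b j <;> simp_all

/-- `{I,Z}`-strings are exactly the `bits t`. [folklore] -/
private theorem eq_bits_of_IZ {b : Fin 3 → Pauli} (h : ∀ j, b j = Pauli.I ∨ b j = Pauli.Z) :
    b = bits fun j => decide (b j = Pauli.Z) := by
  funext j
  rcases h j with hj | hj <;> simp [bits, hj]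

/-- `bits` is injective. [folklore] -/
private theorem bits_injective : Function.Injective bits := by
  intro t t' h
  funext j
  have := congrFun h j
  cases ht : t j <;> cases ht' : t' j <;> simp_all [bits]

/-- **The block aggregation identity**: `Σ_b Tr(Z_1·V b V†)·⟨0|b|0⟩·F(|b|) = 12 F(1) − 4 F(3)` — per block,
the weight-one strings `Z_1, Z_2, Z_3` carry bracket `4` each and `Z_1Z_2Z_3` carries `−4` (so with the
normalisation `8⁻¹`: "`F_2 = 3/2`", "`F_4 = −1/2`", "`F_1 = F_3 = 0`" per block, the output `Z` adding one
to the weight). [cite: GonzalezGarciaCiracTrivedi2025PauliPathBeyondAverageQuantum, Lemma 5 (proof: F_1 = F_3 = 0, F_2 = 3/2, F_4 = −1/2)] -/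
theorem block_sum (F : ℕ → ℂ) :
    ∑ b : Fin 3 → Pauli, (∑ c : Fin 3 → Bool, zSign (majorityFlip c) * pauliString b c c) *
        pauliString b (fun _ => false) (fun _ => false) * F (strWeight b) =
      12 * F 1 - 4 * F 3 := by
  -- restrict to the image of `bits`
  rw [← Finset.sum_subset (Finset.subset_univ (Finset.univ.image bits))]
  · rw [Finset.sum_image fun t _ t' _ h => bits_injective h]
    simp only [pauliString_zero_zero, bits_IZ, implies_true, if_true, mul_one]
    rw [sum_fin3]
    simp only [Fintype.sum_bool, blockAmp_bits, strWeight_bits]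
    norm_num
    ring
  · intro b _ hb
    rw [pauliString_zero_zero, if_neg, mul_zero, zero_mul]
    intro h
    exact hb (Finset.mem_image.2 ⟨_, Finset.mem_univ _, (eq_bits_of_IZ h).symm⟩)

/-! ### The path sum of the witness circuit, block by block -/

/-- The block transition bracket `Tr(Z_1 · V b V†)` of a block input string `b`. [cite: GonzalezGarciaCiracTrivedi2025PauliPathBeyondAverageQuantum, §3 (f(s): tr(s_d U_d s_{d−1} U_d†)) and Lemma 5] -/
def blockAmp (b : Fin 3 → Pauli) : ℂ :=
  (pauliString zII * (majorityGate * pauliString b * majorityGateᴴ)).trace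

/-- The block weight `τ(b) = 8⁻¹ Tr(Z_1·V b V†)·⟨0|b|0⟩` (`1/2` on `Z_1,Z_2,Z_3`, `−1/2` on `Z_1Z_2Z_3`, else `0`).
[cite: GonzalezGarciaCiracTrivedi2025PauliPathBeyondAverageQuantum, Lemma 5 (F_2 = 3/2, F_4 = −1/2 per block)] -/
def blockCoeff (b : Fin 3 → Pauli) : ℂ :=
  (8 : ℂ)⁻¹ * blockAmp b * pauliString b (fun _ => false) (fun _ => false)

/-- The layer `GGCT.layer k` is the block tensor `V^{⊗k}`. [cite: GonzalezGarciaCiracTrivedi2025PauliPathBeyondAverageQuantum, Lemma 5 (𝒞 = V^{⊗n/3})] -/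
theorem layer_eq_blockTensor (k : ℕ) : layer k = blockTensor fun _ : Fin k => majorityGate := rfl

/-- The observable is the block tensor of `Z ⊗ I ⊗ I`. [cite: GonzalezGarciaCiracTrivedi2025PauliPathBeyondAverageQuantum, Lemma 5 (O_k)] -/
theorem pauliString_obs (k : ℕ) : pauliString (obs k) = blockTensor fun _ : Fin k => pauliString zII := by
  rw [pauliString_eq_blockTensor]; rfl

/-- `|Z ⊗ I ⊗ I| = 1`. [cite: GonzalezGarciaCiracTrivedi2025PauliPathBeyondAverageQuantum, Lemma 5] -/
theorem strWeight_zII : strWeight zII = 1 := by decide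

/-- `|O_k| = k`. [cite: GonzalezGarciaCiracTrivedi2025PauliPathBeyondAverageQuantum, Lemma 5 (O_k = ∏_{i ≤ k} Z_{3i−2})] -/
theorem strWeight_obs (k : ℕ) : strWeight (obs k) = k := by
  rw [strWeight_eq_sum_blocks]
  simp [obs_eq_blocks, strWeight_zII]

/-- **The transition amplitude of the layer factorises over the blocks**:
`Tr(O_k · V^{⊗k} a (V^{⊗k})†) = ∏_i Tr(Z_1 · V a_i V†)`. [cite: GonzalezGarciaCiracTrivedi2025PauliPathBeyondAverageQuantum, Lemma 5 (proof, blockwise computation)] -/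
theorem transAmp_layer (k : ℕ) (a : Fin k × Fin 3 → Pauli) :
    transAmp 0 (layer k) a (obs k) = ∏ i, blockAmp fun j => a (i, j) := by
  rw [transAmp, depolarizeAll_rate_zero, layer_eq_blockTensor, pauliString_obs, pauliString_eq_blockTensor a,
    conjTranspose_blockTensor, blockTensor_mul, blockTensor_mul, blockTensor_mul, trace_blockTensor]
  rfl

/-- The input bracket factorises over the blocks: `Tr(a ρ_0) = ∏_i ⟨000|a_i|000⟩`. [cite: GonzalezGarciaCiracTrivedi2025PauliPathBeyondAverageQuantum, Lemma 5 (ρ_0 = (|0⟩⟨0|)^{⊗n})] -/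
theorem trace_pauliString_mul_input (k : ℕ) (a : Fin k × Fin 3 → Pauli) :
    (pauliString a * input k).trace = ∏ i, pauliString (fun j => a (i, j)) (fun _ => false) (fun _ => false) := by
  rw [input, Matrix.trace_mul_comm, trace_proj_mul, pauliString_eq_blockTensor, blockTensor_apply]

/-- The register has `3k` qubits. [folklore] -/
private theorem card_register (k : ℕ) : Fintype.card (Fin k × Fin 3) = k * 3 := by
  rw [Fintype.card_prod, Fintype.card_fin, Fintype.card_fin]

/-- `2^{3k} = 8^k`. [folklore] -/
private theorem two_pow_card_register (k : ℕ) : (2 : ℂ) ^ Fintype.card (Fin k × Fin 3) = 8 ^ k := by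
  rw [card_register, mul_comm, pow_mul]; norm_num

/-- Sums over `1`-tuples. [folklore] -/
private theorem sum_fin_one' {α β : Type*} [Fintype α] [AddCommMonoid β] (g : (Fin 1 → α) → β) :
    ∑ s, g s = ∑ a, g (fun _ => a) := by
  refine Fintype.sum_equiv (Equiv.funUnique (Fin 1) α) _ _ (fun s => ?_)
  congr 1
  funext i
  simp [Fin.fin_one_eq_zero i]

/-- Sums over the paths `(s_0, s_1)` of the depth-one circuit as double sums. [cite: GonzalezGarciaCiracTrivedi2025PauliPathBeyondAverageQuantum, §3 (⟨O⟩ = Σ_{s_0,…,s_d} f(s))] -/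
theorem sum_path_two {α β : Type*} [Fintype α] [AddCommMonoid β] (g : (Fin (1 + 1) → α) → β) :
    ∑ s, g s = ∑ b, ∑ a, g (Fin.snoc (fun _ : Fin 1 => a) b) := by
  rw [← (Fin.snocEquiv fun _ => α).sum_comp, Fintype.sum_prod_type]
  refine Finset.sum_congr rfl fun b _ => ?_
  rw [sum_fin_one']
  rfl

/-- First entry of a `2`-tuple. [folklore] -/
private theorem snoc_pair_zero {α : Type*} (a b : α) : (Fin.snoc (fun _ : Fin 1 => a) b : Fin 2 → α) 0 = a := rfl

/-- Last entry of a `2`-tuple. [folklore] -/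
private theorem snoc_pair_one {α : Type*} (a b : α) : (Fin.snoc (fun _ : Fin 1 => a) b : Fin 2 → α) 1 = b := rfl

/-- `|(s_0, s_1)| = |s_0| + |s_1|`. [cite: GonzalezGarciaCiracTrivedi2025PauliPathBeyondAverageQuantum, §3 (|s| = |s_0| + ⋯ + |s_d|)] -/
theorem pathWeight_pair (k : ℕ) (a b : Fin k × Fin 3 → Pauli) :
    pathWeight (Fin.snoc (fun _ : Fin 1 => a) b : Fin (1 + 1) → Fin k × Fin 3 → Pauli) =
      strWeight a + strWeight b := by
  rw [pathWeight_eq, Fin.sum_univ_two]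
  rfl

/-- **The depth-one path coefficient of the witness, block by block**: `f̃(s_0, s_1)` vanishes unless
`s_1 = O_k`, and then equals `(1−p)^{|s_0|+k} 8^{−k} ∏_i Tr(Z_1·V (s_0)_i V†)·⟨000|(s_0)_i|000⟩`.
[cite: GonzalezGarciaCiracTrivedi2025PauliPathBeyondAverageQuantum, §3 (f(s) = 2^{−n(d+1)} tr(O s_d) tr(s_d U_d s_{d−1} U_d†) ⋯ tr(s_0 ρ_0)) and Lemma 5] -/
theorem pathCoeff_pair (p : ℂ) (k : ℕ) (a b : Fin k × Fin 3 → Pauli) :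
    pathCoeff p (layers k) (input k) (pauliString (obs k)) (Fin.snoc (fun _ : Fin 1 => a) b) =
      if obs k = b then (1 - p) ^ (strWeight a + k) * (((8 : ℂ) ^ k)⁻¹ *
        ((∏ i, blockAmp fun j => a (i, j)) *
          ∏ i, pauliString (fun j => a (i, j)) (fun _ => false) (fun _ => false))) else 0 := by
  rw [pathCoeff_eq_pow_mul_pathCoeff_zero, pathWeight_pair, pathCoeff]
  have h1 : (Fin.snoc (fun _ : Fin 1 => a) b : Fin (1 + 1) → Fin k × Fin 3 → Pauli) (Fin.last 1) = b := rfl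
  have h2 : (Fin.snoc (fun _ : Fin 1 => a) b : Fin (1 + 1) → Fin k × Fin 3 → Pauli) (Fin.castSucc 0) = a := rfl
  have h3 : (Fin.snoc (fun _ : Fin 1 => a) b : Fin (1 + 1) → Fin k × Fin 3 → Pauli) (Fin.succ 0) = b := rfl
  have h4 : (Fin.snoc (fun _ : Fin 1 => a) b : Fin (1 + 1) → Fin k × Fin 3 → Pauli) 0 = a := rfl
  simp only [Fin.prod_univ_one, h1, h2, h3, h4, depolarizeAll_rate_zero, trace_pauliString_mul_pauliString,
    layers, trace_pauliString_mul_input, two_pow_card_register]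
  split_ifs with h
  · subst h
    rw [transAmp_layer, strWeight_obs]
    have h8 : (8 : ℂ) ^ k ≠ 0 := pow_ne_zero _ (by norm_num)
    rw [show (1 + 1 : ℕ) = 2 from rfl, inv_pow]
    generalize (∏ i, blockAmp fun j => a (i, j)) = X
    generalize (∏ i, pauliString (fun j => a (i, j)) (fun _ => false) fun _ => false) = Y
    generalize hB : (8 : ℂ) ^ k = B
    rw [hB] at h8
    rw [pow_two, mul_inv, mul_assoc B X Y, ← mul_assoc (B⁻¹ * B⁻¹) B, mul_assoc B⁻¹ B⁻¹ B,
      inv_mul_cancel₀ h8, mul_one]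
  · simp

/-- **The filtered path sum of the witness circuit, block by block**: for any weight predicate `P`,
`Σ_{s : P|s|} f̃(s) = Σ_{β : blocks} [P(Σᵢ(|βᵢ|+1))] ∏ᵢ (1−p)^{|βᵢ|+1} τ(βᵢ)` — the error `E^{(ℓ)}`, the
truncated and the full sums are this with `P = (· > ℓ)`, `(· ≤ ℓ)`, `⊤`. [cite: GonzalezGarciaCiracTrivedi2025PauliPathBeyondAverageQuantum, §3 (⟨O⟩_ℓ = Σ_{w ≤ ℓ} F_w(1−p)^w, Error = |Σ_{w>ℓ} F_w (1−p)^w|) and Lemma 6] -/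
theorem filter_sum_pathCoeff_eq (p : ℂ) (k : ℕ) (P : ℕ → Prop) [DecidablePred P] :
    ∑ s ∈ Finset.univ.filter (fun s : Fin (1 + 1) → Fin k × Fin 3 → Pauli => P (pathWeight s)),
        pathCoeff p (layers k) (input k) (pauliString (obs k)) s =
      ∑ β : Fin k → Fin 3 → Pauli, if P (∑ i, (strWeight (β i) + 1)) then
        ∏ i, ((1 - p) ^ (strWeight (β i) + 1) * blockCoeff (β i)) else 0 := by
  rw [Finset.sum_filter, sum_path_two]
  -- only `b = obs k` survives
  rw [Finset.sum_eq_single (obs k)]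
  · simp only [pathCoeff_pair, pathWeight_pair, if_true, strWeight_obs]
    rw [sum_curry]
    refine Finset.sum_congr rfl fun β _ => ?_
    have hw : strWeight (fun w : Fin k × Fin 3 => β w.1 w.2) + k = ∑ i, (strWeight (β i) + 1) := by
      rw [strWeight_eq_sum_blocks, Finset.sum_add_distrib, Finset.sum_const, Finset.card_univ,
        Fintype.card_fin, smul_eq_mul, mul_one]
    rw [hw]
    split_ifs with hP
    · rw [← Finset.prod_pow_eq_pow_sum, Finset.prod_mul_distrib]
      simp only [blockCoeff, Finset.prod_mul_distrib, Finset.prod_const, Finset.card_univ, Fintype.card_fin,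
        inv_pow]
      ring
    · rfl
  · intro b _ hb
    refine Finset.sum_eq_zero fun a _ => ?_
    rw [pathCoeff_pair, if_neg (Ne.symm hb), ite_self]
  · intro h; exact absurd (Finset.mem_univ _) h

/-! ### Evaluating the block sum: the binomial closed form -/

/-- The block aggregation identity for `τ`: `Σ_b τ(b) F(|b|) = (3/2) F(1) − (1/2) F(3)`.
[cite: GonzalezGarciaCiracTrivedi2025PauliPathBeyondAverageQuantum, Lemma 5 (F_2 = 3/2, F_4 = −1/2, F_1 = F_3 = 0 per block)] -/
theorem sum_blockCoeff (F : ℕ → ℂ) :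
    ∑ b : Fin 3 → Pauli, blockCoeff b * F (strWeight b) = (3 / 2 : ℂ) * F 1 - (1 / 2 : ℂ) * F 3 := by
  have h := block_sum F
  have hb : ∀ b : Fin 3 → Pauli, ∑ c : Fin 3 → Bool, zSign (majorityFlip c) * pauliString b c c = blockAmp b :=
    fun b => (blockAmp_eq b).symm
  simp only [hb] at h
  have : ∑ b : Fin 3 → Pauli, blockCoeff b * F (strWeight b) =
      (8 : ℂ)⁻¹ * ∑ b : Fin 3 → Pauli, blockAmp b * pauliString b (fun _ => false) (fun _ => false) *
        F (strWeight b) := by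
    rw [Finset.mul_sum]
    refine Finset.sum_congr rfl fun b _ => ?_
    rw [blockCoeff]; ring
  rw [this, h]; ring

/-- The matrix-free block sum with a weight predicate: `S_k(P) = Σ_β [P(Σ(|βᵢ|+1))] ∏ᵢ x^{|βᵢ|+1} τ(βᵢ)`.
[cite: GonzalezGarciaCiracTrivedi2025PauliPathBeyondAverageQuantum, Lemma 6 (E^{(ℓ)}_{𝒞_k} = Σ_{w>ℓ} F_w(𝒞_k)(1−p)^w)] -/
def blockSum (x : ℂ) (k : ℕ) (P : ℕ → Prop) [DecidablePred P] : ℂ :=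
  ∑ β : Fin k → Fin 3 → Pauli, if P (∑ i, (strWeight (β i) + 1)) then
    ∏ i, (x ^ (strWeight (β i) + 1) * blockCoeff (β i)) else 0

/-- Sums over `(L+1)`-tuples split into the last entry and the initial `L`-tuple. [folklore] -/
private theorem sum_snoc' {α M : Type*} [Fintype α] [AddCommMonoid M] {L : ℕ} (g : (Fin (L + 1) → α) → M) :
    ∑ φ, g φ = ∑ a : α, ∑ φ' : Fin L → α, g (Fin.snoc φ' a) := by
  rw [← (Fin.snocEquiv fun _ => α).sum_comp, Fintype.sum_prod_type]
  rfl

/-- Peeling one block off the block sum. [cite: GonzalezGarciaCiracTrivedi2025PauliPathBeyondAverageQuantum, Lemma 6 (proof: F_w(𝒞_k) from the per-block generating function)] -/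
theorem blockSum_succ (x : ℂ) (k : ℕ) (P : ℕ → Prop) [DecidablePred P] :
    blockSum x (k + 1) P = ∑ b : Fin 3 → Pauli, x ^ (strWeight b + 1) * blockCoeff b *
      blockSum x k (fun w => P (w + (strWeight b + 1))) := by
  rw [blockSum, sum_snoc']
  refine Finset.sum_congr rfl fun b _ => ?_
  rw [blockSum, Finset.mul_sum]
  refine Finset.sum_congr rfl fun β _ => ?_
  simp only [Fin.sum_univ_castSucc, Fin.prod_univ_castSucc, Fin.snoc_castSucc, Fin.snoc_last]
  split_ifs <;> ring

/-- **The recursion** `S_{k+1}(P) = (3/2)x² S_k(P(·+2)) − (1/2)x⁴ S_k(P(·+4))` (one more block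
contributes weight `2` with `3/2` or weight `4` with `−1/2`). [cite: GonzalezGarciaCiracTrivedi2025PauliPathBeyondAverageQuantum, Lemma 6 (proof) with Lemma 5] -/
theorem blockSum_succ_eq (x : ℂ) (k : ℕ) (P : ℕ → Prop) [DecidablePred P] :
    blockSum x (k + 1) P = (3 / 2 : ℂ) * x ^ 2 * blockSum x k (fun w => P (w + 2)) -
      (1 / 2 : ℂ) * x ^ 4 * blockSum x k (fun w => P (w + 4)) := by
  rw [blockSum_succ]
  have h := sum_blockCoeff (fun w => x ^ (w + 1) * blockSum x k (fun w' => P (w' + (w + 1))))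
  have e : ∀ b : Fin 3 → Pauli, x ^ (strWeight b + 1) * blockCoeff b *
      blockSum x k (fun w => P (w + (strWeight b + 1))) =
      blockCoeff b * (x ^ (strWeight b + 1) * blockSum x k (fun w' => P (w' + (strWeight b + 1)))) := by
    intro b; ring
  simp only [e] at *
  rw [h]
  ring

/-- Pascal recombination of weighted binomial sums:
`Σ_{j≤k+1} C(k+1,j) y^j f(j) = Σ_{j≤k} C(k,j) y^j f(j) + y Σ_{j≤k} C(k,j) y^j f(j+1)`. [folklore] -/
private theorem pascal_sum (f : ℕ → ℂ) (y : ℂ) (k : ℕ) :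
    ∑ j ∈ Finset.range (k + 2), (Nat.choose (k + 1) j : ℂ) * y ^ j * f j =
      ∑ j ∈ Finset.range (k + 1), (Nat.choose k j : ℂ) * y ^ j * f j +
        y * ∑ j ∈ Finset.range (k + 1), (Nat.choose k j : ℂ) * y ^ j * f (j + 1) := by
  rw [Finset.sum_range_succ' _ (k + 1)]
  simp only [Nat.choose_succ_succ', Nat.cast_add, add_mul, Finset.sum_add_distrib, Nat.choose_zero_right,
    Nat.cast_one, pow_zero, one_mul]
  rw [Finset.sum_range_succ (fun j => (Nat.choose k (j + 1) : ℂ) * y ^ (j + 1) * f (j + 1)) k,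
    Nat.choose_succ_self, Nat.cast_zero, zero_mul, zero_mul, add_zero,
    Finset.sum_range_succ' (fun j => (Nat.choose k j : ℂ) * y ^ j * f j) k]
  simp only [Nat.choose_zero_right, Nat.cast_one, pow_zero, one_mul, Finset.mul_sum]
  have : ∀ j, y * ((Nat.choose k j : ℂ) * y ^ j * f (j + 1)) = (Nat.choose k j : ℂ) * y ^ (j + 1) * f (j + 1) := by
    intro j; ring
  simp only [this]
  ring

/-- **The binomial closed form of the block sum**:
`S_k(P) = ((3/2)x²)^k Σ_{j ≤ k} [P(2k+2j)] C(k,j) (−x²/3)^j` — i.e. `F_{2k+2j}(𝒞_k) = C(k,j)(3/2)^{k−j}(−1/2)^j`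
and all other `F_w(𝒞_k) = 0` ("`F_{2k} = (3/2)^k`"). [cite: GonzalezGarciaCiracTrivedi2025PauliPathBeyondAverageQuantum, Lemma 5 (F_{2k} = (3/2)^k) and Lemma 6 (i)–(iv)] -/
theorem blockSum_eq (x : ℂ) : ∀ (k : ℕ) (P : ℕ → Prop) [DecidablePred P],
    blockSum x k P = ((3 / 2 : ℂ) * x ^ 2) ^ k *
      ∑ j ∈ Finset.range (k + 1), if P (2 * k + 2 * j) then (Nat.choose k j : ℂ) * (-(x ^ 2) / 3) ^ j else 0 := by
  intro k
  induction k with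
  | zero =>
    intro P _
    simp [blockSum]
  | succ k ih =>
    intro P _
    rw [blockSum_succ_eq, ih, ih]
    have hf2 : ∀ j : ℕ, (if P (2 * (k + 1) + 2 * j) then (Nat.choose k j : ℂ) * (-(x ^ 2) / 3) ^ j else 0) =
          (Nat.choose k j : ℂ) * (-(x ^ 2) / 3) ^ j * (if P (2 * (k + 1) + 2 * j) then 1 else 0) := by
      intro j; split_ifs <;> simp
    have hf4 : ∀ j : ℕ, (if P (2 * (k + 1) + 2 * (j + 1)) then (Nat.choose k j : ℂ) * (-(x ^ 2) / 3) ^ j else 0) =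
          (Nat.choose k j : ℂ) * (-(x ^ 2) / 3) ^ j * (if P (2 * (k + 1) + 2 * (j + 1)) then 1 else 0) := by
      intro j; split_ifs <;> simp
    have hg : ∀ j : ℕ, (if P (2 * (k + 1) + 2 * j) then (Nat.choose (k + 1) j : ℂ) * (-(x ^ 2) / 3) ^ j else 0) =
        (Nat.choose (k + 1) j : ℂ) * (-(x ^ 2) / 3) ^ j * (if P (2 * (k + 1) + 2 * j) then 1 else 0) := by
      intro j; split_ifs <;> simp
    simp only [hg]
    rw [pascal_sum (fun j => if P (2 * (k + 1) + 2 * j) then (1 : ℂ) else 0)]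
    have h2 : ∀ j, (2 * k + 2 * j + 2) = 2 * (k + 1) + 2 * j := fun j => by ring
    have h4 : ∀ j, (2 * k + 2 * j + 4) = 2 * (k + 1) + 2 * (j + 1) := fun j => by ring
    simp only [h2, h4, hf2, hf4]
    ring

/-- The unrestricted block sum is the `k`-th power of the block generating value:
`Σ_w F_w(𝒞_k) x^w = ((3/2)x² − x⁴/2)^k`. [cite: GonzalezGarciaCiracTrivedi2025PauliPathBeyondAverageQuantum, Lemma 6 (proof: ⟨O_k⟩ = Σ_w F_w (1−p)^w)] -/
theorem blockSum_true (x : ℂ) (k : ℕ) :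
    blockSum x k (fun _ => True) = ((3 / 2 : ℂ) * x ^ 2 - (1 / 2 : ℂ) * x ^ 4) ^ k := by
  rw [blockSum]
  simp only [if_true]
  rw [← Fintype.prod_sum (fun (_ : Fin k) (b : Fin 3 → Pauli) => x ^ (strWeight b + 1) * blockCoeff b)]
  have h := sum_blockCoeff (fun w => x ^ (w + 1))
  have e : ∀ b : Fin 3 → Pauli, x ^ (strWeight b + 1) * blockCoeff b = blockCoeff b * x ^ (strWeight b + 1) :=
    fun b => mul_comm _ _
  simp only [e, h, Finset.prod_const, Finset.card_univ, Fintype.card_fin]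

/-! ### The error of the weight-`ℓ` truncation in closed form -/

/-- The filtered path sum is the block sum `S_k(P)` at `x = 1 − p`. [cite: GonzalezGarciaCiracTrivedi2025PauliPathBeyondAverageQuantum, Lemma 6] -/
theorem filter_sum_pathCoeff_eq_blockSum (p : ℂ) (k : ℕ) (P : ℕ → Prop) [DecidablePred P] :
    ∑ s ∈ Finset.univ.filter (fun s : Fin (1 + 1) → Fin k × Fin 3 → Pauli => P (pathWeight s)),
        pathCoeff p (layers k) (input k) (pauliString (obs k)) s = blockSum (1 - p) k P :=
  filter_sum_pathCoeff_eq p k P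

/-- **The truncation error of the witness in closed form**:
`⟨O_k⟩_err − ⟨O_k⟩_ℓ = E^{(ℓ)}_{𝒞_k} = ((3/2)x²)^k Σ_{j ≤ k, 2k+2j > ℓ} C(k,j) (−x²/3)^j`, `x = 1 − p`.
[cite: GonzalezGarciaCiracTrivedi2025PauliPathBeyondAverageQuantum, Lemma 6 (E^{(ℓ)}_{𝒞_k} = Σ_{w>ℓ} F_w(𝒞_k)(1−p)^w)] -/
theorem error_eq (p : ℂ) (k ℓ : ℕ) :
    noisyValue p (layers k) (input k) (pauliString (obs k)) -
        truncValue p ℓ (layers k) (input k) (pauliString (obs k)) =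
      ((3 / 2 : ℂ) * (1 - p) ^ 2) ^ k *
        ∑ j ∈ Finset.range (k + 1),
          if ¬ (2 * k + 2 * j ≤ ℓ) then (Nat.choose k j : ℂ) * (-((1 - p) ^ 2) / 3) ^ j else 0 := by
  rw [noisyValue_sub_truncValue, filter_sum_pathCoeff_eq_blockSum p k (fun w => ¬ w ≤ ℓ), blockSum_eq]

/-- **The noisy value of the witness in closed form**: `⟨O_k⟩_err = ((3/2)(1−p)² − (1−p)⁴/2)^k`
(in particular bounded by `1`, being the noisy expectation of a `±1`-valued observable).
[cite: GonzalezGarciaCiracTrivedi2025PauliPathBeyondAverageQuantum, Lemma 6 (proof) and §3 (⟨O⟩_err = Σ_s f(s)(1−p)^{|s|})] -/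
theorem noisyValue_eq (p : ℂ) (k : ℕ) :
    noisyValue p (layers k) (input k) (pauliString (obs k)) =
      ((3 / 2 : ℂ) * (1 - p) ^ 2 - (1 / 2 : ℂ) * (1 - p) ^ 4) ^ k := by
  rw [noisyValue_eq_sum_pathCoeff, ← blockSum_true (1 - p) k,
    ← filter_sum_pathCoeff_eq_blockSum p k (fun _ => True), Finset.filter_true_of_mem fun _ _ => trivial]

/-- The weight-`ℓ` truncated value in closed form: `⟨O_k⟩_ℓ = ((3/2)x²)^k Σ_{j ≤ k, 2k+2j ≤ ℓ} C(k,j)(−x²/3)^j`.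
[cite: GonzalezGarciaCiracTrivedi2025PauliPathBeyondAverageQuantum, §3 (⟨O⟩_ℓ = Σ_{w≤ℓ} F_w (1−p)^w) and Lemma 6] -/
theorem truncValue_eq (p : ℂ) (k ℓ : ℕ) :
    truncValue p ℓ (layers k) (input k) (pauliString (obs k)) =
      ((3 / 2 : ℂ) * (1 - p) ^ 2) ^ k *
        ∑ j ∈ Finset.range (k + 1),
          if 2 * k + 2 * j ≤ ℓ then (Nat.choose k j : ℂ) * (-((1 - p) ^ 2) / 3) ^ j else 0 := by
  rw [truncValue, filter_sum_pathCoeff_eq_blockSum p k (fun w => w ≤ ℓ), blockSum_eq]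

/-! ### Alternating binomial partial sums (the estimate behind Lemma 6 (v)) -/

/-- Alternating sums with nondecreasing terms: even partial sums stay above the first term, odd partial
sums are at most minus the last increment (the mechanism of the lower bound: the kept low-weight part is a
truncated alternating binomial sum whose terms grow). [cite: GonzalezGarciaCiracTrivedi2025PauliPathBeyondAverageQuantum, Lemma 6 (v) (proof)] -/
theorem alt_sum_bounds (a : ℕ → ℝ) (m : ℕ) (hmono : ∀ j, j < m → a j ≤ a (j + 1)) :
    (∀ n, 2 * n ≤ m → a 0 ≤ ∑ j ∈ Finset.range (2 * n + 1), (-1 : ℝ) ^ j * a j) ∧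
    (∀ n, 2 * n + 1 ≤ m → ∑ j ∈ Finset.range (2 * n + 2), (-1 : ℝ) ^ j * a j ≤ a (2 * n) - a (2 * n + 1)) := by
  have key : ∀ n, (2 * n ≤ m → a 0 ≤ ∑ j ∈ Finset.range (2 * n + 1), (-1 : ℝ) ^ j * a j) ∧
      (2 * n + 1 ≤ m → ∑ j ∈ Finset.range (2 * n + 2), (-1 : ℝ) ^ j * a j ≤ a (2 * n) - a (2 * n + 1)) := by
    intro n
    induction n with
    | zero =>
      constructor
      · intro _; simp
      · intro _
        simp [Finset.sum_range_succ]
    | succ n ih =>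
      have he : ∀ i, (-1 : ℝ) ^ (2 * i) = 1 := fun i => by rw [pow_mul]; norm_num
      have s1 : (-1 : ℝ) ^ (2 * n + 1) = -1 := by rw [pow_succ, he]; norm_num
      have s2 : (-1 : ℝ) ^ (2 * n + 1 + 1) = 1 := by rw [pow_succ, s1]; norm_num
      have s3 : (-1 : ℝ) ^ (2 * n + 2) = 1 := s2
      have s4 : (-1 : ℝ) ^ (2 * n + 2 + 1) = -1 := by rw [pow_succ, s3]; norm_num
      constructor
      · intro h
        have h1 := ih.1 (by omega)
        have hm1 : a (2 * n + 1) ≤ a (2 * n + 1 + 1) := hmono (2 * n + 1) (by omega)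
        rw [show 2 * (n + 1) + 1 = 2 * n + 1 + 1 + 1 by ring, Finset.sum_range_succ, Finset.sum_range_succ,
          s1, s2]
        linarith
      · intro h
        have h2 := ih.2 (by omega)
        have hm0 : a (2 * n) ≤ a (2 * n + 1) := hmono (2 * n) (by omega)
        rw [show 2 * (n + 1) + 2 = 2 * n + 2 + 1 + 1 by ring, Finset.sum_range_succ, Finset.sum_range_succ,
          show 2 * (n + 1) = 2 * n + 2 by ring, s3, s4]
        linarith
  exact ⟨fun n => (key n).1, fun n => (key n).2⟩

/-- Geometric growth along a range: `r a_j ≤ a_{j+1}` for `j < m` gives `r^j a_0 ≤ a_j` for `j ≤ m`. [folklore] -/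
private theorem geom_lower (a : ℕ → ℝ) (m : ℕ) (r : ℝ) (hr : 0 ≤ r) (hgrow : ∀ j, j < m → r * a j ≤ a (j + 1)) :
    ∀ j, j ≤ m → r ^ j * a 0 ≤ a j := by
  intro j
  induction j with
  | zero => intro _; simp
  | succ j ih =>
    intro hj
    have h1 := ih (by omega)
    have h2 := hgrow j (by omega)
    calc r ^ (j + 1) * a 0 = r * (r ^ j * a 0) := by ring
      _ ≤ r * a j := mul_le_mul_of_nonneg_left h1 hr
      _ ≤ a (j + 1) := h2

/-- The binomial theorem `Σ_{j≤k} C(k,j) y^j = (1+y)^k`. [folklore] -/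
private theorem sum_range_choose_mul_pow (k : ℕ) (y : ℝ) :
    ∑ j ∈ Finset.range (k + 1), (Nat.choose k j : ℝ) * y ^ j = (1 + y) ^ k := by
  rw [show (1 + y) = y + 1 by ring, add_pow]
  refine Finset.sum_congr rfl fun j _ => ?_
  rw [one_pow, mul_one, mul_comm]

/-- The kept binomial terms `a_j = C(k,j) t^j` grow by a factor `≥ 14/9` while `8(j+1) ≤ k` and `t ≥ 2/9`
(the window `ℓ ≤ 9k/4` keeps only `j ≤ k/8` low-weight classes). [cite: GonzalezGarciaCiracTrivedi2025PauliPathBeyondAverageQuantum, Lemma 6 (v) (the range 2k < ℓ ≤ 9k/4)] -/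
theorem choose_growth (k : ℕ) (t : ℝ) (ht : 2 / 9 ≤ t) (j : ℕ) (hj : 8 * (j + 1) ≤ k) :
    (14 / 9 : ℝ) * ((Nat.choose k j : ℝ) * t ^ j) ≤ (Nat.choose k (j + 1) : ℝ) * t ^ (j + 1) := by
  have hjk : j ≤ k := by omega
  have hrec : (Nat.choose k (j + 1) : ℝ) * (j + 1) = (Nat.choose k j : ℝ) * ((k : ℝ) - j) := by
    have h := Nat.choose_succ_right_eq k j
    have hc : ((k - j : ℕ) : ℝ) = (k : ℝ) - j := by rw [Nat.cast_sub hjk]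
    rw [← hc]
    exact_mod_cast h
  have hj1 : (0 : ℝ) < j + 1 := by positivity
  have hC : (0 : ℝ) ≤ (Nat.choose k j : ℝ) := by positivity
  have htj : (0 : ℝ) ≤ t ^ j := by positivity
  have hk : (8 : ℝ) * (j + 1) ≤ k := by exact_mod_cast hj
  -- multiply the claim by `j + 1`
  refine le_of_mul_le_mul_right ?_ hj1
  calc 14 / 9 * ((Nat.choose k j : ℝ) * t ^ j) * (j + 1)
      = ((Nat.choose k j : ℝ) * t ^ j) * ((14 / 9) * (j + 1)) := by ring
    _ ≤ ((Nat.choose k j : ℝ) * t ^ j) * (((k : ℝ) - j) * t) := by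
        refine mul_le_mul_of_nonneg_left ?_ (mul_nonneg hC htj)
        nlinarith
    _ = (Nat.choose k (j + 1) : ℝ) * (j + 1) * t ^ (j + 1) := by rw [hrec]; ring
    _ = (Nat.choose k (j + 1) : ℝ) * t ^ (j + 1) * (j + 1) := by ring

/-- The kept partial sum: `Σ_{j ≤ k, 2k+2j ≤ ℓ} f(j) = Σ_{j ≤ m} f(j)` with `m = ⌊(ℓ − 2k)/2⌋ ≤ k`. [cite: GonzalezGarciaCiracTrivedi2025PauliPathBeyondAverageQuantum, Lemma 6 (proof)] -/
theorem sum_kept_eq (k ℓ m : ℕ) (hm : ∀ j, 2 * k + 2 * j ≤ ℓ ↔ j ≤ m) (hmk : m ≤ k) (f : ℕ → ℝ) :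
    ∑ j ∈ Finset.range (k + 1), (if 2 * k + 2 * j ≤ ℓ then f j else 0) = ∑ j ∈ Finset.range (m + 1), f j := by
  rw [← Finset.sum_filter]
  congr 1
  ext j
  simp only [Finset.mem_filter, Finset.mem_range, hm]
  omega

/-- **Lemma 6 (v) as a real inequality**: for `2/3 < u ≤ 1` (`u = (1−p)²`), `2k < ℓ` and `4ℓ ≤ 9k`:
`((3/2)u)^k − 1 ≤ |((3/2)u)^k · Σ_{j ≤ k, 2k+2j > ℓ} C(k,j)(−u/3)^j|`. Proof: with `m = ⌊(ℓ−2k)/2⌋ ≤ k/8`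
the kept sum `Σ_{j≤m} C(k,j)(−u/3)^j` is an alternating sum with terms growing by `≥ 14/9`; it is `≥ 1`
for `m` even, `≤ −1` for odd `m ≥ 3`, and `= 1 − ku/3` for `m = 1` (then `k ≥ 8`, and `k = 8` is checked by
hand); the full sum is `((3/2)u(1−u/3))^k ∈ [0,1]`. [cite: GonzalezGarciaCiracTrivedi2025PauliPathBeyondAverageQuantum, Lemma 6 (v) ("|E^{(ℓ)}_{𝒞_k}| ≥ ((3/2)(1−p)²)^k − 1 = 2^{Ω(ℓ)}, ∀p < 1−√(2/3)")] -/
theorem lemma6v_real (u : ℝ) (hu : 2 / 3 < u) (hu1 : u ≤ 1) (k ℓ : ℕ) (hkl : 2 * k < ℓ) (hlk : 4 * ℓ ≤ 9 * k) :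
    (3 / 2 * u) ^ k - 1 ≤
      |(3 / 2 * u) ^ k * ∑ j ∈ Finset.range (k + 1),
        (if ¬ (2 * k + 2 * j ≤ ℓ) then (Nat.choose k j : ℝ) * (-u / 3) ^ j else 0)| := by
  set X : ℝ := 3 / 2 * u with hX
  set t : ℝ := u / 3 with ht
  set m : ℕ := (ℓ - 2 * k) / 2 with hm
  have hX1 : 1 < X := by rw [hX]; linarith
  have hXk : 0 < X ^ k := by positivity
  have ht29 : 2 / 9 < t := by rw [ht]; linarith
  have hm_iff : ∀ j, 2 * k + 2 * j ≤ ℓ ↔ j ≤ m := by intro j; rw [hm]; omega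
  have hm8 : 8 * m ≤ k := by rw [hm]; omega
  have hmk : m ≤ k := by omega
  -- the kept and the discarded parts add up to `(1 − t)^k`
  set a : ℕ → ℝ := fun j => (Nat.choose k j : ℝ) * t ^ j with ha
  have hneg : ∀ j, (Nat.choose k j : ℝ) * (-u / 3) ^ j = (-1) ^ j * a j := by
    intro j; rw [ha]; dsimp only; rw [ht, show -u / 3 = (-1) * (u / 3) by ring, mul_pow]; ring
  have hsplit : ∑ j ∈ Finset.range (k + 1), (if ¬ (2 * k + 2 * j ≤ ℓ) then (Nat.choose k j : ℝ) * (-u / 3) ^ j else 0) =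
      (1 - t) ^ k - ∑ j ∈ Finset.range (m + 1), (-1) ^ j * a j := by
    rw [← sum_kept_eq k ℓ m hm_iff hmk, eq_sub_iff_add_eq, ← Finset.sum_add_distrib]
    rw [show (1 - t) = 1 + (-u / 3) by rw [ht]; ring, ← sum_range_choose_mul_pow]
    refine Finset.sum_congr rfl fun j _ => ?_
    rw [← hneg]
    split_ifs <;> simp
  rw [hsplit]
  -- `G = (X(1−t))^k ∈ [0, 1]`
  have hG0 : 0 ≤ (X * (1 - t)) ^ k := by
    apply pow_nonneg; rw [hX, ht]; nlinarith
  have hG1 : (X * (1 - t)) ^ k ≤ 1 := by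
    apply pow_le_one₀
    · rw [hX, ht]; nlinarith
    · rw [hX, ht]; nlinarith
  clear_value X t
  have hE : X ^ k * ((1 - t) ^ k - ∑ j ∈ Finset.range (m + 1), (-1) ^ j * a j) =
      (X * (1 - t)) ^ k - X ^ k * ∑ j ∈ Finset.range (m + 1), (-1) ^ j * a j := by rw [mul_pow]; ring
  rw [hE]
  -- growth of the kept terms
  have hgrow : ∀ j, j < m → (14 / 9 : ℝ) * a j ≤ a (j + 1) := by
    intro j hj
    exact choose_growth k t (le_of_lt ht29) j (by omega)
  have hpos : ∀ j, 0 ≤ a j := fun j => by rw [ha]; positivity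
  have hmono : ∀ j, j < m → a j ≤ a (j + 1) := by
    intro j hj; have := hgrow j hj; have := hpos j; linarith
  have ha0 : a 0 = 1 := by rw [ha]; simp
  obtain ⟨heven, hodd⟩ := alt_sum_bounds a m hmono
  rcases Nat.even_or_odd m with ⟨n, hn⟩ | ⟨n, hn⟩
  · -- `m = 2n`: the kept sum is `≥ 1`, so `T ≥ X^k` and `E ≤ 1 − X^k`
    have h1 : a 0 ≤ ∑ j ∈ Finset.range (m + 1), (-1 : ℝ) ^ j * a j := by
      have := heven n (by omega); rwa [show 2 * n = m by omega] at this
    rw [ha0] at h1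
    have h2 : X ^ k ≤ X ^ k * ∑ j ∈ Finset.range (m + 1), (-1 : ℝ) ^ j * a j := by
      nlinarith
    rw [abs_sub_comm]
    refine le_trans ?_ (le_abs_self _)
    linarith
  · -- `m = 2n + 1`
    have h1 : ∑ j ∈ Finset.range (m + 1), (-1 : ℝ) ^ j * a j ≤ a (2 * n) - a (2 * n + 1) := by
      have := hodd n (by omega); rwa [show 2 * n + 2 = m + 1 by omega] at this
    rcases Nat.lt_or_ge m 3 with hm3 | hm3
    · -- `m = 1`: `T = X^k (1 − k t)`
      have hm1 : m = 1 := by omega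
      have hn0 : n = 0 := by omega
      subst hn0
      have hsum : ∑ j ∈ Finset.range (m + 1), (-1 : ℝ) ^ j * a j = 1 - k * t := by
        rw [hm1, Finset.sum_range_succ, Finset.sum_range_succ, Finset.sum_range_zero, ha]
        simp
        ring
      rw [hsum]
      have hk8 : 8 ≤ k := by omega
      refine le_trans ?_ (le_abs_self _)
      -- need `(X(1-t))^k − X^k (1 − k t) ≥ X^k − 1`, i.e. `G + X^k (k t − 2) + 1 ≥ 0`
      by_cases hkt : 2 ≤ (k : ℝ) * t
      · nlinarith
      · -- then `k = 8` and `X < 9/8`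
        have hk9 : k < 9 := by
          by_contra h9
          push Not at h9
          have : (9 : ℝ) ≤ k := by exact_mod_cast h9
          nlinarith
        have hk : k = 8 := by omega
        subst hk
        have hkt' : (8 : ℝ) * t < 2 := by push_cast at hkt; linarith
        have hu34 : u < 3 / 4 := by rw [ht] at hkt'; linarith
        have hX98 : X < 9 / 8 := by rw [hX]; linarith
        have hX8 : X ^ 8 < (9 / 8 : ℝ) ^ 8 := pow_lt_pow_left₀ hX98 (by linarith) (by norm_num)
        have h98 : (9 / 8 : ℝ) ^ 8 < 2.57 := by norm_num
        have hlow : -(2 / 9 : ℝ) < 8 * t - 2 := by linarith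
        push_cast
        nlinarith [mul_le_mul_of_nonneg_left (le_of_lt hlow) (le_of_lt hXk)]
    · -- `m ≥ 3`, odd: the kept sum is `≤ −1`
      have hgm : (14 / 9 : ℝ) ^ m * a 0 ≤ a m := geom_lower a m (14 / 9) (by norm_num) hgrow m le_rfl
      rw [ha0, mul_one] at hgm
      have h3 : (14 / 9 : ℝ) ^ 3 ≤ (14 / 9 : ℝ) ^ m := pow_le_pow_right₀ (by norm_num) hm3
      have hlast : (14 / 9 : ℝ) * a (2 * n) ≤ a (2 * n + 1) := hgrow (2 * n) (by omega)
      have hm' : a m = a (2 * n + 1) := by rw [hn]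
      have hS : ∑ j ∈ Finset.range (m + 1), (-1 : ℝ) ^ j * a j ≤ -1 := by
        have : a (2 * n) - a (2 * n + 1) ≤ -(5 / 14) * a (2 * n + 1) := by linarith
        have h4 : (14 / 9 : ℝ) ^ 3 ≤ a (2 * n + 1) := by rw [← hm']; linarith
        nlinarith
      refine le_trans ?_ (le_abs_self _)
      nlinarith

end GGCT

open GGCT in
/-- **Discharge of the barrier fact** `pauliPathTruncation_worstCase` (González-García–Cirac–Trivedi,
Lemma 6 (v) for the circuit of Lemma 5): the weight-`ℓ` truncation of the Pauli path sum of the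
one-layer majority circuit errs by at least `((3/2)(1−p)²)^k − 1` for `2k < ℓ ≤ 9k/4`, `0 ≤ p < 1 − √(2/3)`.
[cite: GonzalezGarciaCiracTrivedi2025PauliPathBeyondAverageQuantum, Lemma 6 (v) (with Lemma 5)] -/
theorem pauliPathTruncation_worstCase_holds : pauliPathTruncation_worstCase := by
  intro p hp0 hp1 k ℓ hkl hlk
  have hs : (0 : ℝ) ≤ Real.sqrt (2 / 3) := Real.sqrt_nonneg _
  have hple : p ≤ 1 := by linarith
  have hu : 2 / 3 < (1 - p) ^ 2 := by
    have h := (threshold_iff hple).2 hp1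
    linarith
  have hu1 : (1 - p) ^ 2 ≤ 1 := by nlinarith
  have hcast : noisyValue (p : ℂ) (layers k) (input k) (pauliString (obs k)) -
      truncValue (p : ℂ) ℓ (layers k) (input k) (pauliString (obs k)) =
      (((3 / 2 * (1 - p) ^ 2) ^ k * ∑ j ∈ Finset.range (k + 1),
        (if ¬ (2 * k + 2 * j ≤ ℓ) then (Nat.choose k j : ℝ) * (-((1 - p) ^ 2) / 3) ^ j else 0) : ℝ) : ℂ) := by
    rw [error_eq]
    push_cast
    refine congrArg _ (Finset.sum_congr rfl fun j _ => ?_)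
    split_ifs <;> simp
  rw [hcast, Complex.norm_real, Real.norm_eq_abs]
  exact lemma6v_real ((1 - p) ^ 2) hu hu1 k ℓ hkl hlk

end Literature.Barriers.QuantumAdvantage
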